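import Literature.AlgebraicGeometry.AbelianSchemes.IsLambdaOfAtRigidityOnTorsion
import Literature.AlgebraicGeometry.AbelianSchemes.IsLambdaOfAtAlongDualIsogeny
import Literature.AlgebraicGeometry.AbelianSchemes.AbelianSchemeDualIsogenyHom
import Literature.AlgebraicGeometry.AbelianSchemes.AbelianSchemeQuotientMulNDescent
import Literature.AlgebraicGeometry.Motives.AbelianVarietyWeilPairingDeterminesWeilDivisor
import Literature.AlgebraicGeometry.Motives.AbelianVarietyWeilPairingPullback
import Literature.AlgebraicGeometry.Motives.AbelianVarietyWeilPairingAlgClosure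
import Literature.AlgebraicGeometry.AbelianSchemes.AbelianSchemeSymplecticLevel
import HarnessLib

/-!
# The SIMILITUDE LAW `h ≫ λ₂ ≫ h^∨ = λ₁ ≫ [ν]` of a homomorphism READ ON SYMPLECTIC TORSION TOWERS
# ([MumfordAV1970] §20 (1)–(3), §23; [Lang1983AbelianVarieties] VII §2 Prop. 3–4; [Lan2013PELCompactifications] §1.3.6)

Topic `AlgebraicGeometry/AbelianSchemes`, namespace `Literature.AlgebraicGeometry.AbelianSchemes.AbelianSchemeOver`.  THEOREMS ONLY (no definition, no named fact,
no `instance`, no notation, no `sorry`).  Cell `hodgecm-mathlib` (D-0151), F0∕P6 «MOD», «GO 500» half A line L5 (EHECKE closer `Lines/F0_P6a_StubEHECKE.lean` of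
LA5-plan (g3); assemblers (O-R1) LA5-p01 (g3), (O-R2) A-p06 (g35)): **organ (ρ-SIM) §2 — the binder `hsim` of ★ `exists_roof_of_idealHomFamily_of_isAlgClosed`
(p849956), `h ≫ λ₂ ≫ h^∨ = λ₁ ≫ [ν]` over `Spec Ω`, from the level Weil pairings of the two fibres**, over ★ `IsLambdaOfAtRigidityOnTorsion` (p850023, the scheme half),
★ `IsLambdaOfAtAlongDualIsogeny` (`h ≫ λ₂ ≫ h^∨ = Λ(𝒪(h^*Θ₂))`), ★ `Motives/AbelianVarietyWeilPairingDeterminesWeilDivisor` (Lang VII §2 Prop. 4) and ★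
`Motives/AbelianVarietyWeilPairingPullback` ([MumfordAV1970] §20 (3)).  A-p06 (g35); `--supports stmt-HodgeConjecture-24832`, count-neutral.  HONEST LABEL: HC_CM is proved only
modulo the 7 printed citations (2 remaining: hLiu418 = stmt-HodgeConjecture-24832, h413 = stmt-HodgeConjecture-24833) until rung 0 closes; this file is generic and
discharges none of them.

## Mathematics

`Ω` algebraically closed of characteristic `0`; `A₁, A₂` abelian schemes over `Spec Ω` with dual pairs `(Âᵢ, 𝒫ᵢ)` (unit pins), homomorphisms `λᵢ : Aᵢ → Âᵢ` which are
`Λ(𝒪(Θᵢ))` at the point (★ `IsLambdaOfAt`), and a DOMINANT homomorphism `h : A₁ → A₂` (an isogeny).  Three steps, the last two purely divisorial ∕ arithmetical: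
(§1) `h ≫ λ₂ ≫ h^∨ = Λ(𝒪(h^*Θ₂))` (★ `IsLambdaOfAt.pullback_dualIsogeny`, [MumfordAV1970] §23 «`Λ(ψ^*L) = ψ̂ Λ(L) ψ`») and `λ₁ ≫ [ν] = λ₁^ν = Λ(𝒪(ν•Θ₁))` (★
`IsLambdaOfAt.pow_nsmul`), so by RIGIDITY ON TORSION (★ `eq_of_isLambdaOfAt_of_forall_torsion_weilDiv_linEquiv`) **`h ≫ λ₂ ≫ h^∨ = λ₁ ≫ [ν]` as soon as
`D^{h^*Θ₂}_Q ∼ D^{ν•Θ₁}_Q` for every torsion `Q ∈ A₁(Ω)`**; (§2) that congruence follows from the LEVEL WEIL PAIRINGS: if on a cofinal tower of levels `N ∣ M`,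
`ē^{Θ₂}_M(h a, h b) = ē^{Θ₁}_M(a, b)^ν` for all `a, b ∈ A₁[M]` then `ē^{h^*Θ₂}_M(a, Q) = ē^{Θ₂}_M(h a, h Q)` ([MumfordAV1970] §20 (3), ★ `weilPairingLevel_pullback_eq`)
`= ē^{Θ₁}_M(a, Q)^ν = ē^{Θ₁}_M(a, Q^ν)` for all `a`, whence `D^{h^*Θ₂}_Q ∼ D^{Θ₁}_{Q^ν} ∼ ν•D^{Θ₁}_Q ∼ D^{ν•Θ₁}_Q` ([Lang1983AbelianVarieties] VII §2 Prop. 4: `e_M` is perfect on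
`A[M] × Pic[M]`, ★ `weilDiv_linEquiv_weilDiv_zpow_of_forall_weilPairingLevel_eq_zpow`; theorem of the square ★ `nsmul_weilDiv_linEquiv`, ★ `weilDiv_nsmul_linEquiv`);
(§3) the pairing identity itself is what SYMPLECTIC TOWERS deliver ([Lan2013PELCompactifications] Lemma 1.3.6.5: `ē^{Θᵢ}_M(lᵢ x, lᵢ y) = ζ_M^{E_δ(x,y)}` for surjective
level maps `lᵢ : (ℤ∕M)^{2g} → Aᵢ[M](Ω)` with the SAME roots `ζ_M`): if `h(l₁ x) = l₂(T̄ x)` for a map `T̄` with `E_δ(T̄x, T̄y) = ν E_δ(x, y)` (mod `M`) — `h` READS A SYMPLECTIC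
SIMILITUDE OF MULTIPLIER `ν` — then `ē^{Θ₂}_M(h a, h b) = ζ_M^{ν E_δ(x,y)} = ē^{Θ₁}_M(a, b)^ν`.  (§4) assembles: towers ⇒ `h ≫ λ₂ ≫ h^∨ = λ₁ ≫ [ν]`.  In the EHECKE
application `ν = p²` at `h = h_p`, the towers are the symplectic lifts of the two admissible readings (★ L6 `Reads`), `T̄ = T·M₁(p)` through the torsion parametrisations.

## Contents
* §0 `pow_eq_pow_of_mod_eq`, `pow_val_natCast_mul`, `AbelianVariety.mem_torsionPoints_mul_of_mem` (arithmetic);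
* §1 `comp_lam_comp_dualIsogenyOver_eq_mulN_of_forall_torsion_weilDiv_linEquiv` — divisor congruence on torsion ⇒ the law;
* §2 `weilDiv_pullback_linEquiv_nsmul_of_weilPairingLevel` (one level), `forall_torsion_weilDiv_linEquiv_of_weilPairingLevel` (cofinal tower) — pairings ⇒ congruence;
* §3 `weilPairingLevel_map_eq_pow_of_towerReading` — symplectic tower reading ⇒ pairing identity at one level;
* §4 **`comp_lam_comp_dualIsogenyOver_eq_mulN_of_weilPairingLevel`**, **`comp_lam_comp_dualIsogenyOver_eq_mulN_of_towerReading`** — THE HEADS.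

## References
* [MumfordAV1970] D. Mumford, *Abelian Varieties* (1970), §20 properties (1)–(3) of `e_n` (pp. 183–186), §23 (Thm. 2, p. 231), §8 (`φ_L`).
* [Lang1983AbelianVarieties] S. Lang, *Abelian Varieties* (1983), Ch. VII §2 Prop. 3 and Prop. 4 (PDF pp. 138–140).
* [Lan2013PELCompactifications] K.-W. Lan, *Arithmetic compactifications of PEL-type Shimura varieties* (2013), §1.3.6 Def. 1.3.6.1–2 (pp. 79–80), Lemma 1.3.6.5 (p. 81).
* [MumfordFogartyKirwan1994] D. Mumford, J. Fogarty, F. Kirwan, *Geometric Invariant Theory*, 3rd ed., Ch. 6 §2 Def. 6.2–6.3, (6.3) (pp. 120–121).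
* [Milne1986AbelianVarieties] J. S. Milne, *Abelian varieties* (1986), §12 Lemma 12.6, §16 (p. 132).
* Tree: ★ `IsLambdaOfAtRigidityOnTorsion`, ★ `IsLambdaOfAtAlongDualIsogeny`, ★ `Motives/AbelianVarietyWeilPairingDeterminesWeilDivisor`, ★ `Motives/AbelianVarietyWeilPairingPullback`.
-/

set_option autoImplicit false

noncomputable section

universe u

open CategoryTheory CategoryTheory.Limits AlgebraicGeometry MonoidalCategory
open scoped MonObj

namespace Literature.AlgebraicGeometry.AbelianSchemes

namespace AbelianSchemeOver

open Literature.AlgebraicGeometry.Motives Literature.AlgebraicGeometry.AbelianVarieties Literature.AlgebraicGeometry.Modules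

/-! ### §0 Arithmetic of roots of unity and torsion levels -/

/-- Exponents of an `M`-th root of unity only matter mod `M`. [cite: Lan2013PELCompactifications, §1.3.6 Def. 1.3.6.1 (pp. 79–80)] -/
theorem pow_eq_pow_of_mod_eq {Ω : Type u} [Field Ω] {M : ℕ} {ζ : Ω} (hζ : ζ ^ M = 1) {a b : ℕ} (hab : a % M = b % M) : ζ ^ a = ζ ^ b := by
  rw [← Nat.div_add_mod a M, ← Nat.div_add_mod b M, pow_add, pow_add, pow_mul, pow_mul, hζ, one_pow, one_pow, hab]

/-- `ζ ^ (ν • e).val = (ζ ^ e.val) ^ ν` for `ζ^M = 1` and `e ∈ ℤ∕M`. [cite: Lan2013PELCompactifications, §1.3.6 Def. 1.3.6.1 (pp. 79–80)] -/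
theorem pow_val_natCast_mul {Ω : Type u} [Field Ω] {M : ℕ} [NeZero M] {ζ : Ω} (hζ : ζ ^ M = 1) (ν : ℕ) (e : ZMod M) :
    ζ ^ ((ν : ZMod M) * e).val = (ζ ^ e.val) ^ ν := by
  rw [← pow_mul, mul_comm e.val ν]
  refine pow_eq_pow_of_mod_eq hζ ?_
  rw [ZMod.val_mul, ZMod.val_natCast, Nat.mod_mod, Nat.mul_mod, Nat.mod_mod, ← Nat.mul_mod]

/-- A torsion point of order dividing `n` is `M`-torsion for `M = N·n`. [cite: MumfordAV1970, §20 (p. 183)] -/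
theorem _root_.Literature.AlgebraicGeometry.Motives.AbelianVariety.mem_torsionPoints_mul_of_mem {K : Type u} [Field K]
    (B : AbelianVariety K) {n : ℕ} (N : ℕ) {Q : B.Points K} (hQ : Q ∈ B.torsionPoints K n) :
    Q ∈ B.torsionPoints K ((N * n : ℕ) : ℤ) := by
  rw [AbelianVariety.mem_torsionPoints_iff] at hQ ⊢
  rw [zpow_natCast] at hQ
  rw [zpow_natCast, mul_comm, pow_mul, hQ, one_pow]

variable {Ω : Type u} [Field Ω] {A₁ A₂ : AbelianSchemeOver (Spec (.of Ω))} (h : A₁.X ⟶ A₂.X) [IsMonHom h]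

/-! ### §1 Divisor congruence on torsion ⇒ `h ≫ λ₂ ≫ h^∨ = λ₁ ≫ [ν]` -/

/-- **`h ≫ λ₂ ≫ h^∨ = λ₁ ≫ [ν]` FROM `D^{h^*Θ₂}_Q ∼ D^{ν•Θ₁}_Q` ON TORSION `Q`**: `h ≫ λ₂ ≫ h^∨` is `Λ(𝒪(h^*Θ₂))` (★ `IsLambdaOfAt.pullback_dualIsogeny`) and `λ₁ ≫ [ν] = λ₁^ν` is
`Λ(𝒪(ν•Θ₁))` (★ `IsLambdaOfAt.pow_nsmul`); rigidity on torsion (★ `eq_of_isLambdaOfAt_of_forall_torsion_weilDiv_linEquiv`).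
[cite: MumfordAV1970, §23 (Thm. 2, p. 231) and §19 Thm. 3 (p. 176)] [cite: MumfordFogartyKirwan1994, Ch. 6 §2 Definition 6.2–6.3 (p. 120)] -/
theorem comp_lam_comp_dualIsogenyOver_eq_mulN_of_forall_torsion_weilDiv_linEquiv [IsAlgClosed Ω] [CharZero Ω]
    [IsDominant (AbelianVariety.Hom.toSchemeHom (fibreHom h (𝟙 (Spec (.of Ω)))))]
    (D₁ : A₁.DualPair) (D₂ : A₂.DualPair)
    (hD₁ : Nonempty ((Scheme.Modules.pullback (DualPair.unitHatSlice D₁)).obj D₁.P ≅ SheafOfModules.unit _))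
    (hD₂ : Nonempty ((Scheme.Modules.pullback (DualPair.unitHatSlice D₂)).obj D₂.P ≅ SheafOfModules.unit _))
    (lam₁ : A₁.X ⟶ D₁.hat.X) (lam₂ : A₂.X ⟶ D₂.hat.X) [IsMonHom lam₁] [IsMonHom lam₂] (ν : ℕ)
    {Θ₁ : CartierDivisor (A₁.fibre (𝟙 _)).toAbelianVariety.X.left} {Θ₂ : CartierDivisor (A₂.fibre (𝟙 _)).toAbelianVariety.X.left}
    (hΘ₁ : A₁.IsLambdaOfAt (𝟙 _) D₁ lam₁ Θ₁) (hΘ₂ : A₂.IsLambdaOfAt (𝟙 _) D₂ lam₂ Θ₂)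
    (hdiv : ∀ n : ℕ, 0 < n → ∀ Q ∈ (A₁.fibre (𝟙 _)).toAbelianVariety.torsionPoints Ω n,
      ((A₁.fibre (𝟙 _)).toAbelianVariety.weilDiv (Θ₂.pullback (AbelianVariety.Hom.toSchemeHom (fibreHom h (𝟙 _)))) Q).LinEquiv
        ((A₁.fibre (𝟙 _)).toAbelianVariety.weilDiv (ν • Θ₁) Q)) :
    h ≫ lam₂ ≫ DualPair.dualIsogenyOver h D₁ D₂ = lam₁ ≫ D₁.hat.mulN ν := by
  haveI : IsCommMonObj D₁.hat.X := D₁.hat.isCommMonObj_of_isReduced_base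
  haveI := DualPair.isMonHom_dualIsogenyOver h D₁ D₂ hD₂ hD₁
  haveI : IsMonHom (D₁.hat.mulN ν) := D₁.hat.isMonHom_mulN ν
  have hL : A₁.IsLambdaOfAt (𝟙 _) D₁ (h ≫ lam₂ ≫ DualPair.dualIsogenyOver h D₁ D₂)
      (Θ₂.pullback (AbelianVariety.Hom.toSchemeHom (fibreHom h (𝟙 _)))) :=
    IsLambdaOfAt.pullback_dualIsogeny h D₁ D₂ (𝟙 _) lam₂ Θ₂ hΘ₂
  have hpow : A₁.IsLambdaOfAt (𝟙 _) D₁ (lam₁ ^ ν) (ν • Θ₁) := IsLambdaOfAt.pow_nsmul A₁ D₁ lam₁ (𝟙 _) ν hΘ₁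
  have heq : lam₁ ^ ν = lam₁ ≫ D₁.hat.mulN ν := by rw [mulN_def, MonObj.comp_pow, Category.comp_id]
  rw [heq] at hpow
  exact eq_of_isLambdaOfAt_of_forall_torsion_weilDiv_linEquiv D₁ _ _ hL hpow hdiv

/-! ### §2 Level Weil pairings ⇒ the divisor congruence on torsion -/

/-- **ONE LEVEL**: if `(M : Ω) ≠ 0` and `ē^{Θ₂}_M(h a, h Q) = ē^{Θ₁}_M(a, Q)^ν` for all `a ∈ A₁[M]`, then `D^{h^*Θ₂}_Q ∼ D^{ν•Θ₁}_Q` ([MumfordAV1970] §20 (3) `ē^{h^*Θ}(a,b) = ē^Θ(ha,hb)`, ★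
`weilPairingLevel_pullback_eq`; [Lang] VII §2 Prop. 4, ★ `weilDiv_linEquiv_weilDiv_zpow_of_forall_weilPairingLevel_eq_zpow`; theorem of the square).
[cite: MumfordAV1970, §20 property (3) (p. 186)] [cite: Lang1983AbelianVarieties, Ch. VII §2 Prop. 3 and Prop. 4] -/
theorem weilDiv_pullback_linEquiv_nsmul_of_weilPairingLevel [IsAlgClosed Ω]
    [IsDominant (AbelianVariety.Hom.toSchemeHom (fibreHom h (𝟙 (Spec (.of Ω)))))] (ν : ℕ) {M : ℕ} (hMΩ : (M : Ω) ≠ 0)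
    (Θ₁ : CartierDivisor (A₁.fibre (𝟙 _)).toAbelianVariety.X.left) (Θ₂ : CartierDivisor (A₂.fibre (𝟙 _)).toAbelianVariety.X.left)
    (Q : (A₁.fibre (𝟙 _)).toAbelianVariety.torsionPoints Ω M)
    (hpair : haveI := (A₁.fibre (𝟙 _)).toAbelianVariety.isDominant_toSchemeHom_zsmul_of_ne_zero hMΩ
      haveI := (A₂.fibre (𝟙 _)).toAbelianVariety.isDominant_toSchemeHom_zsmul_of_ne_zero hMΩ
      ∀ a : (A₁.fibre (𝟙 _)).toAbelianVariety.torsionPoints Ω M,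
        (A₂.fibre (𝟙 _)).toAbelianVariety.weilPairingLevel Θ₂
            ⟨AlgPoints.map (fibreHom h (𝟙 _)).hom.hom.hom a.1, AbelianVariety.map_mem_torsionPoints (fibreHom h (𝟙 _)) a.2⟩
            ⟨AlgPoints.map (fibreHom h (𝟙 _)).hom.hom.hom Q.1, AbelianVariety.map_mem_torsionPoints (fibreHom h (𝟙 _)) Q.2⟩ =
          (A₁.fibre (𝟙 _)).toAbelianVariety.weilPairingLevel Θ₁ a Q ^ ν) :
    ((A₁.fibre (𝟙 _)).toAbelianVariety.weilDiv (Θ₂.pullback (AbelianVariety.Hom.toSchemeHom (fibreHom h (𝟙 _)))) Q.1).LinEquiv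
      ((A₁.fibre (𝟙 _)).toAbelianVariety.weilDiv (ν • Θ₁) Q.1) := by
  haveI := (A₁.fibre (𝟙 _)).toAbelianVariety.isDominant_toSchemeHom_zsmul_of_ne_zero hMΩ
  haveI := (A₂.fibre (𝟙 _)).toAbelianVariety.isDominant_toSchemeHom_zsmul_of_ne_zero hMΩ
  have h1 : ((A₁.fibre (𝟙 _)).toAbelianVariety.weilDiv (Θ₂.pullback (AbelianVariety.Hom.toSchemeHom (fibreHom h (𝟙 _)))) Q.1).LinEquiv
      ((A₁.fibre (𝟙 _)).toAbelianVariety.weilDiv Θ₁ (Q.1 ^ (ν : ℤ))) := by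
    refine AbelianVariety.weilDiv_linEquiv_weilDiv_zpow_of_forall_weilPairingLevel_eq_zpow hMΩ Θ₁ _ Q (ν : ℤ) fun a => ?_
    rw [AbelianVariety.weilPairingLevel_pullback (fibreHom h (𝟙 _)) Θ₂ a Q, zpow_natCast]
    exact hpair a
  rw [zpow_natCast] at h1
  exact h1.trans (((A₁.fibre (𝟙 _)).toAbelianVariety.nsmul_weilDiv_linEquiv Θ₁ Q.1 ν).symm.trans
    ((A₁.fibre (𝟙 _)).toAbelianVariety.weilDiv_nsmul_linEquiv Θ₁ Q.1 ν).symm)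

/-- **COFINAL TOWER**: if the pairing identity `ē^{Θ₂}_M(h a, h b) = ē^{Θ₁}_M(a, b)^ν` holds at every level `M` with `N ∣ M`, `M ≠ 0` in `Ω`, then `D^{h^*Θ₂}_Q ∼ D^{ν•Θ₁}_Q`
for EVERY torsion point `Q` (a point of order `n` is seen at the level `M = N·n`; characteristic `0`). [cite: MumfordAV1970, §20 (pp. 183–186)] [cite: Lang1983AbelianVarieties, Ch. VII §2 Prop. 4] -/
theorem forall_torsion_weilDiv_linEquiv_of_weilPairingLevel [IsAlgClosed Ω] [CharZero Ω]
    [IsDominant (AbelianVariety.Hom.toSchemeHom (fibreHom h (𝟙 (Spec (.of Ω)))))] (ν : ℕ) {N : ℕ} (hN : N ≠ 0)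
    (Θ₁ : CartierDivisor (A₁.fibre (𝟙 _)).toAbelianVariety.X.left) (Θ₂ : CartierDivisor (A₂.fibre (𝟙 _)).toAbelianVariety.X.left)
    (hpair : ∀ (M : ℕ), N ∣ M → ∀ (hMΩ : (M : Ω) ≠ 0),
      haveI := (A₁.fibre (𝟙 _)).toAbelianVariety.isDominant_toSchemeHom_zsmul_of_ne_zero hMΩ
      haveI := (A₂.fibre (𝟙 _)).toAbelianVariety.isDominant_toSchemeHom_zsmul_of_ne_zero hMΩ
      ∀ a b : (A₁.fibre (𝟙 _)).toAbelianVariety.torsionPoints Ω M,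
        (A₂.fibre (𝟙 _)).toAbelianVariety.weilPairingLevel Θ₂
            ⟨AlgPoints.map (fibreHom h (𝟙 _)).hom.hom.hom a.1, AbelianVariety.map_mem_torsionPoints (fibreHom h (𝟙 _)) a.2⟩
            ⟨AlgPoints.map (fibreHom h (𝟙 _)).hom.hom.hom b.1, AbelianVariety.map_mem_torsionPoints (fibreHom h (𝟙 _)) b.2⟩ =
          (A₁.fibre (𝟙 _)).toAbelianVariety.weilPairingLevel Θ₁ a b ^ ν) :
    ∀ n : ℕ, 0 < n → ∀ Q ∈ (A₁.fibre (𝟙 _)).toAbelianVariety.torsionPoints Ω n,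
      ((A₁.fibre (𝟙 _)).toAbelianVariety.weilDiv (Θ₂.pullback (AbelianVariety.Hom.toSchemeHom (fibreHom h (𝟙 _)))) Q).LinEquiv
        ((A₁.fibre (𝟙 _)).toAbelianVariety.weilDiv (ν • Θ₁) Q) := by
  intro n hn Q hQ
  have hM0 : N * n ≠ 0 := mul_ne_zero hN hn.ne'
  have hMΩ : ((N * n : ℕ) : Ω) ≠ 0 := by exact_mod_cast hM0
  exact weilDiv_pullback_linEquiv_nsmul_of_weilPairingLevel h ν hMΩ Θ₁ Θ₂ ⟨Q, (A₁.fibre (𝟙 _)).toAbelianVariety.mem_torsionPoints_mul_of_mem N hQ⟩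
    (fun a => hpair (N * n) (Dvd.intro n rfl) hMΩ a _)

/-! ### §3 A symplectic tower reading ⇒ the pairing identity at one level -/

/-- **A HOMOMORPHISM READING A SYMPLECTIC SIMILITUDE OF MULTIPLIER `ν` ON THE LEVEL-`M` TOWERS scales the level Weil pairings by `ν`**: if `l₁ : (ℤ∕M)^{2g} ↠ A₁[M](Ω)` and
`l₂ : (ℤ∕M)^{2g} → A₂[M](Ω)` are symplectic for `Θ₁`, `Θ₂` with the SAME root `ζ_M` (`ē^{Θᵢ}_M(lᵢ x, lᵢ y) = ζ_M ^ E_δ(x, y)`, [Lan2013PELCompactifications] Lemma 1.3.6.5 ∕ ★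
`SymplecticLift.pairing`) and `h(l₁ x) = l₂(T̄ x)` with `E_δ(T̄ x, T̄ y) = ν E_δ(x, y)`, then `ē^{Θ₂}_M(h a, h b) = ē^{Θ₁}_M(a, b)^ν` for all `a, b ∈ A₁[M](Ω)`.
[cite: Lan2013PELCompactifications, §1.3.6 Lemma 1.3.6.5 (p. 81)] [cite: MumfordAV1970, §20 (p. 186)] [cite: Milne2005ShimuraVarieties, §6 p. 75] -/
theorem weilPairingLevel_map_eq_pow_of_towerReading {M : ℕ} (hMΩ : (M : Ω) ≠ 0) {g' : ℕ} (δ : Fin g' → ℕ) (ν : ℕ) {ζ : Ω} (hζ : ζ ^ M = 1)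
    (Θ₁ : CartierDivisor (A₁.fibre (𝟙 _)).toAbelianVariety.X.left) (Θ₂ : CartierDivisor (A₂.fibre (𝟙 _)).toAbelianVariety.X.left)
    (l₁ : (Fin g' ⊕ Fin g' → ZMod M) → (A₁.fibre (𝟙 _)).toAbelianVariety.torsionPoints Ω M) (hl₁ : Function.Surjective l₁)
    (l₂ : (Fin g' ⊕ Fin g' → ZMod M) → (A₂.fibre (𝟙 _)).toAbelianVariety.torsionPoints Ω M)
    (he₁ : haveI := (A₁.fibre (𝟙 _)).toAbelianVariety.isDominant_toSchemeHom_zsmul_of_ne_zero hMΩ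
      ∀ x y, (A₁.fibre (𝟙 _)).toAbelianVariety.weilPairingLevel Θ₁ (l₁ x) (l₁ y) = ζ ^ (typeFormMod δ M x y).val)
    (he₂ : haveI := (A₂.fibre (𝟙 _)).toAbelianVariety.isDominant_toSchemeHom_zsmul_of_ne_zero hMΩ
      ∀ x y, (A₂.fibre (𝟙 _)).toAbelianVariety.weilPairingLevel Θ₂ (l₂ x) (l₂ y) = ζ ^ (typeFormMod δ M x y).val)
    (T : (Fin g' ⊕ Fin g' → ZMod M) → (Fin g' ⊕ Fin g' → ZMod M))
    (hT : ∀ x, AlgPoints.map (fibreHom h (𝟙 _)).hom.hom.hom (l₁ x).1 = (l₂ (T x)).1)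
    (hν : ∀ x y, typeFormMod δ M (T x) (T y) = (ν : ZMod M) * typeFormMod δ M x y) :
    haveI := (A₁.fibre (𝟙 _)).toAbelianVariety.isDominant_toSchemeHom_zsmul_of_ne_zero hMΩ
    haveI := (A₂.fibre (𝟙 _)).toAbelianVariety.isDominant_toSchemeHom_zsmul_of_ne_zero hMΩ
    ∀ a b : (A₁.fibre (𝟙 _)).toAbelianVariety.torsionPoints Ω M,
      (A₂.fibre (𝟙 _)).toAbelianVariety.weilPairingLevel Θ₂
          ⟨AlgPoints.map (fibreHom h (𝟙 _)).hom.hom.hom a.1, AbelianVariety.map_mem_torsionPoints (fibreHom h (𝟙 _)) a.2⟩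
          ⟨AlgPoints.map (fibreHom h (𝟙 _)).hom.hom.hom b.1, AbelianVariety.map_mem_torsionPoints (fibreHom h (𝟙 _)) b.2⟩ =
        (A₁.fibre (𝟙 _)).toAbelianVariety.weilPairingLevel Θ₁ a b ^ ν := by
  haveI : NeZero M := ⟨by rintro rfl; exact hMΩ (by simp)⟩
  intro a b
  obtain ⟨x, rfl⟩ := hl₁ a
  obtain ⟨y, rfl⟩ := hl₁ b
  have ha : (⟨AlgPoints.map (fibreHom h (𝟙 _)).hom.hom.hom (l₁ x).1, AbelianVariety.map_mem_torsionPoints (fibreHom h (𝟙 _)) (l₁ x).2⟩ :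
      (A₂.fibre (𝟙 _)).toAbelianVariety.torsionPoints Ω M) = l₂ (T x) := Subtype.ext (hT x)
  have hb : (⟨AlgPoints.map (fibreHom h (𝟙 _)).hom.hom.hom (l₁ y).1, AbelianVariety.map_mem_torsionPoints (fibreHom h (𝟙 _)) (l₁ y).2⟩ :
      (A₂.fibre (𝟙 _)).toAbelianVariety.torsionPoints Ω M) = l₂ (T y) := Subtype.ext (hT y)
  rw [ha, hb, he₂, hν, he₁, pow_val_natCast_mul hζ]

/-! ### §4 THE HEADS -/

/-- **THE SIMILITUDE LAW FROM THE LEVEL WEIL PAIRINGS**: over an algebraically closed field of characteristic `0`, if `h : A₁ → A₂` is dominant, `λᵢ = Λ(𝒪(Θᵢ))` at the point, and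
on a cofinal tower of levels `N ∣ M` the level pairings satisfy `ē^{Θ₂}_M(h a, h b) = ē^{Θ₁}_M(a, b)^ν` on `A₁[M](Ω)`, then **`h ≫ λ₂ ≫ h^∨ = λ₁ ≫ [ν]`** (§2 ⇒ §1).
[cite: MumfordAV1970, §20 (pp. 183–186) and §23 (Thm. 2, p. 231)] [cite: Lang1983AbelianVarieties, Ch. VII §2 Prop. 4] [cite: MumfordFogartyKirwan1994, Ch. 6 §2 (6.3) (p. 121)] -/
theorem comp_lam_comp_dualIsogenyOver_eq_mulN_of_weilPairingLevel [IsAlgClosed Ω] [CharZero Ω]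
    [IsDominant (AbelianVariety.Hom.toSchemeHom (fibreHom h (𝟙 (Spec (.of Ω)))))]
    (D₁ : A₁.DualPair) (D₂ : A₂.DualPair)
    (hD₁ : Nonempty ((Scheme.Modules.pullback (DualPair.unitHatSlice D₁)).obj D₁.P ≅ SheafOfModules.unit _))
    (hD₂ : Nonempty ((Scheme.Modules.pullback (DualPair.unitHatSlice D₂)).obj D₂.P ≅ SheafOfModules.unit _))
    (lam₁ : A₁.X ⟶ D₁.hat.X) (lam₂ : A₂.X ⟶ D₂.hat.X) [IsMonHom lam₁] [IsMonHom lam₂] (ν : ℕ) {N : ℕ} (hN : N ≠ 0)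
    {Θ₁ : CartierDivisor (A₁.fibre (𝟙 _)).toAbelianVariety.X.left} {Θ₂ : CartierDivisor (A₂.fibre (𝟙 _)).toAbelianVariety.X.left}
    (hΘ₁ : A₁.IsLambdaOfAt (𝟙 _) D₁ lam₁ Θ₁) (hΘ₂ : A₂.IsLambdaOfAt (𝟙 _) D₂ lam₂ Θ₂)
    (hpair : ∀ (M : ℕ), N ∣ M → ∀ (hMΩ : (M : Ω) ≠ 0),
      haveI := (A₁.fibre (𝟙 _)).toAbelianVariety.isDominant_toSchemeHom_zsmul_of_ne_zero hMΩ
      haveI := (A₂.fibre (𝟙 _)).toAbelianVariety.isDominant_toSchemeHom_zsmul_of_ne_zero hMΩ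
      ∀ a b : (A₁.fibre (𝟙 _)).toAbelianVariety.torsionPoints Ω M,
        (A₂.fibre (𝟙 _)).toAbelianVariety.weilPairingLevel Θ₂
            ⟨AlgPoints.map (fibreHom h (𝟙 _)).hom.hom.hom a.1, AbelianVariety.map_mem_torsionPoints (fibreHom h (𝟙 _)) a.2⟩
            ⟨AlgPoints.map (fibreHom h (𝟙 _)).hom.hom.hom b.1, AbelianVariety.map_mem_torsionPoints (fibreHom h (𝟙 _)) b.2⟩ =
          (A₁.fibre (𝟙 _)).toAbelianVariety.weilPairingLevel Θ₁ a b ^ ν) :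
    h ≫ lam₂ ≫ DualPair.dualIsogenyOver h D₁ D₂ = lam₁ ≫ D₁.hat.mulN ν :=
  comp_lam_comp_dualIsogenyOver_eq_mulN_of_forall_torsion_weilDiv_linEquiv h D₁ D₂ hD₁ hD₂ lam₁ lam₂ ν hΘ₁ hΘ₂
    (forall_torsion_weilDiv_linEquiv_of_weilPairingLevel h ν hN Θ₁ Θ₂ hpair)

/-- **THE SIMILITUDE LAW OF A HOMOMORPHISM READ ON SYMPLECTIC TORSION TOWERS** — the `hsim` binder of ★ `exists_roof_of_idealHomFamily_of_isAlgClosed`: over an algebraically closed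
field of characteristic `0`, let `h : A₁ → A₂` be dominant, `λᵢ = Λ(𝒪(Θᵢ))` at the point, and on every level `M` with `N ∣ M`, `M ≠ 0` let there be symplectic level maps
`l₁ : (ℤ∕M)^{2g} ↠ A₁[M](Ω)`, `l₂ : (ℤ∕M)^{2g} → A₂[M](Ω)` for `Θ₁`, `Θ₂` with the SAME root `ζ_M` (`ζ_M^M = 1`) — e.g. the symplectic lifts of two level structures (★ `SymplecticLift`:
`lift M`, `pairing`, `ζ_pow_eq_one`, `lift_bijective`) — and a map `T̄_M` with `h(l₁ x) = l₂(T̄_M x)` and `E_δ(T̄_M x, T̄_M y) = ν·E_δ(x, y)`: THEN **`h ≫ λ₂ ≫ h^∨ = λ₁ ≫ [ν]`**.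
[cite: MumfordAV1970, §20 (pp. 183–186) and §23 (Thm. 2, p. 231)] [cite: Lan2013PELCompactifications, §1.3.6 Lemma 1.3.6.5 (p. 81)] [cite: Lang1983AbelianVarieties, Ch. VII §2 Prop. 4]
[cite: Milne2005ShimuraVarieties, §6 Thm. 6.11 p. 74 and p. 75] -/
theorem comp_lam_comp_dualIsogenyOver_eq_mulN_of_towerReading [IsAlgClosed Ω] [CharZero Ω]
    [IsDominant (AbelianVariety.Hom.toSchemeHom (fibreHom h (𝟙 (Spec (.of Ω)))))]
    (D₁ : A₁.DualPair) (D₂ : A₂.DualPair)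
    (hD₁ : Nonempty ((Scheme.Modules.pullback (DualPair.unitHatSlice D₁)).obj D₁.P ≅ SheafOfModules.unit _))
    (hD₂ : Nonempty ((Scheme.Modules.pullback (DualPair.unitHatSlice D₂)).obj D₂.P ≅ SheafOfModules.unit _))
    (lam₁ : A₁.X ⟶ D₁.hat.X) (lam₂ : A₂.X ⟶ D₂.hat.X) [IsMonHom lam₁] [IsMonHom lam₂] (ν : ℕ) {N : ℕ} (hN : N ≠ 0) {g' : ℕ} (δ : Fin g' → ℕ)
    {Θ₁ : CartierDivisor (A₁.fibre (𝟙 _)).toAbelianVariety.X.left} {Θ₂ : CartierDivisor (A₂.fibre (𝟙 _)).toAbelianVariety.X.left}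
    (hΘ₁ : A₁.IsLambdaOfAt (𝟙 _) D₁ lam₁ Θ₁) (hΘ₂ : A₂.IsLambdaOfAt (𝟙 _) D₂ lam₂ Θ₂)
    (ζ : ℕ → Ω) (hζ : ∀ M, N ∣ M → M ≠ 0 → ζ M ^ M = 1)
    (l₁ : ∀ M : ℕ, (Fin g' ⊕ Fin g' → ZMod M) → (A₁.fibre (𝟙 _)).toAbelianVariety.torsionPoints Ω M)
    (hl₁ : ∀ M, N ∣ M → M ≠ 0 → Function.Surjective (l₁ M))
    (l₂ : ∀ M : ℕ, (Fin g' ⊕ Fin g' → ZMod M) → (A₂.fibre (𝟙 _)).toAbelianVariety.torsionPoints Ω M)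
    (he₁ : ∀ (M : ℕ), N ∣ M → ∀ (hMΩ : (M : Ω) ≠ 0), haveI := (A₁.fibre (𝟙 _)).toAbelianVariety.isDominant_toSchemeHom_zsmul_of_ne_zero hMΩ
      ∀ x y, (A₁.fibre (𝟙 _)).toAbelianVariety.weilPairingLevel Θ₁ (l₁ M x) (l₁ M y) = ζ M ^ (typeFormMod δ M x y).val)
    (he₂ : ∀ (M : ℕ), N ∣ M → ∀ (hMΩ : (M : Ω) ≠ 0), haveI := (A₂.fibre (𝟙 _)).toAbelianVariety.isDominant_toSchemeHom_zsmul_of_ne_zero hMΩ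
      ∀ x y, (A₂.fibre (𝟙 _)).toAbelianVariety.weilPairingLevel Θ₂ (l₂ M x) (l₂ M y) = ζ M ^ (typeFormMod δ M x y).val)
    (T : ∀ M : ℕ, (Fin g' ⊕ Fin g' → ZMod M) → (Fin g' ⊕ Fin g' → ZMod M))
    (hT : ∀ M, N ∣ M → M ≠ 0 → ∀ x, AlgPoints.map (fibreHom h (𝟙 _)).hom.hom.hom (l₁ M x).1 = (l₂ M (T M x)).1)
    (hν : ∀ M, N ∣ M → M ≠ 0 → ∀ x y, typeFormMod δ M (T M x) (T M y) = (ν : ZMod M) * typeFormMod δ M x y) :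
    h ≫ lam₂ ≫ DualPair.dualIsogenyOver h D₁ D₂ = lam₁ ≫ D₁.hat.mulN ν := by
  refine comp_lam_comp_dualIsogenyOver_eq_mulN_of_weilPairingLevel h D₁ D₂ hD₁ hD₂ lam₁ lam₂ ν hN hΘ₁ hΘ₂ fun M hNM hMΩ => ?_
  have hM0 : M ≠ 0 := by rintro rfl; exact hMΩ (by simp)
  exact weilPairingLevel_map_eq_pow_of_towerReading h hMΩ δ ν (hζ M hNM hM0) Θ₁ Θ₂ (l₁ M) (hl₁ M hNM hM0) (l₂ M)
    (he₁ M hNM hMΩ) (he₂ M hNM hMΩ) (T M) (hT M hNM hM0) (hν M hNM hM0)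

end AbelianSchemeOver

end Literature.AlgebraicGeometry.AbelianSchemes

end
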